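import Mathlib
import Summits.ResolutionOfSingularities.ResolutionOfSingularities.Theorems.HomologicalConductorPersistenceInversion
import Summits.ResolutionOfSingularities.ResolutionOfSingularities.Theorems.SyzygyFlatteningHigherRankTerminationEssFiniteType
import Summits.ResolutionOfSingularities.ResolutionOfSingularities.Theorems.SyzygyFlatteningHigherRankTerminationNrmLocAt
import HarnessLib

/-!
# Normalisation commutes with adjoining inverses

Crux `HomologicalConductor.Persistence` (stmt-ResolutionOfSingularities-16484), line `birth`,
registered stub `stub_nrm_adjoin_inv`.

For a field extension `K / k`, a `k`-subalgebra `C` of `K` and a set `T ⊆ C`, write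
`X[T⁻¹] = Algebra.adjoin k (↑X ∪ {t⁻¹ | t ∈ T})` and
`nrm X = Algebra.adjoin k {y | y integral over X}` (`Theorems.SyzygyFlattening.nrm`, whose
carrier is the set of elements of `K` integral over `X`, `mem_nrm_iff`). Then
`nrm (C[T⁻¹]) = (nrm C)[T⁻¹]` as subalgebras of `K`.

* `⊇`: `nrm` is monotone (tree `nrm_mono`), and `C ≤ C[T⁻¹] ≤ nrm (C[T⁻¹])`.
* `⊆` (integral closure commutes with localisation, Stacks 0307): `L = C[T⁻¹]` is, through the
  inclusion `C ≤ L`, the localisation of `C` at the preimage `U` of the units of `L` (tree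
  `isLocalization_of_forall_exists_eq_mul_inv`, fed by
  `exists_eq_mul_inv_of_mem_adjoin_union_inv`), so an element `y ∈ K` integral over `L` has
  `m * y` integral over `C` for some `m ∈ U` (Mathlib
  `IsIntegral.exists_multiple_integral_of_isLocalization`); then `m⁻¹ ∈ L ≤ (nrm C)[T⁻¹]`,
  `m * y ∈ nrm C ≤ (nrm C)[T⁻¹]`, and `y = m⁻¹ * (m * y)`.
-/

-- single-problem summit: the doubled namespace component is forced
set_option linter.dupNamespace false

noncomputable section

namespace Summit.ResolutionOfSingularities.ResolutionOfSingularities.Theorems.HomologicalConductor.PersistenceNrmAdjoinInv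

open Summit.ResolutionOfSingularities.ResolutionOfSingularities.Theorems.HomologicalConductor.PersistenceInversion
  (isLocalization_of_forall_exists_eq_mul_inv le_adjoin_union_inv
    exists_eq_mul_inv_of_mem_adjoin_union_inv)
open Summit.ResolutionOfSingularities.ResolutionOfSingularities.Theorems.SyzygyFlattening
  (nrm mem_nrm_iff self_le_nrm nrm_mono)

section

variable {k K : Type} [Field k] [Field K] [Algebra k K]

/-- **Integrality descends from `C[T⁻¹]` up to a unit** (integral closure commutes with
localisation). If `T ⊆ C` and `y ∈ K` is integral over `L = C[t⁻¹ | t ∈ T]`, then `m * y` is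
integral over `C` for some `m ∈ C` with `m ≠ 0` and `m⁻¹ ∈ L`: `L` is the localisation of `C`
at the preimage of its units, and one clears denominators in a monic equation
(`IsIntegral.exists_multiple_integral_of_isLocalization`). [cite: StacksProject, Tag 0307] -/
theorem exists_mul_isIntegral_of_isIntegral_adjoin_union_inv (C : Subalgebra k K) (T : Set K)
    (hT : T ⊆ ↑C) {y : K}
    (hy : IsIntegral ↥(Algebra.adjoin k ((C : Set K) ∪ {y : K | ∃ t ∈ T, y = t⁻¹})) y) :
    ∃ m ∈ C, m ≠ 0 ∧ m⁻¹ ∈ Algebra.adjoin k ((C : Set K) ∪ {y : K | ∃ t ∈ T, y = t⁻¹}) ∧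
      IsIntegral ↥C (m * y) := by
  have hCL : C ≤ Algebra.adjoin k ((C : Set K) ∪ {y : K | ∃ t ∈ T, y = t⁻¹}) :=
    le_adjoin_union_inv C T
  letI : Algebra ↥C ↥(Algebra.adjoin k ((C : Set K) ∪ {y : K | ∃ t ∈ T, y = t⁻¹})) :=
    (Subalgebra.inclusion hCL).toRingHom.toAlgebra
  haveI : IsScalarTower ↥C ↥(Algebra.adjoin k ((C : Set K) ∪ {y : K | ∃ t ∈ T, y = t⁻¹})) K :=
    IsScalarTower.of_algebraMap_eq fun _ => rfl
  haveI : IsLocalization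
      ((IsUnit.submonoid ↥(Algebra.adjoin k ((C : Set K) ∪ {y : K | ∃ t ∈ T, y = t⁻¹}))).comap
        (algebraMap ↥C ↥(Algebra.adjoin k ((C : Set K) ∪ {y : K | ∃ t ∈ T, y = t⁻¹}))))
      ↥(Algebra.adjoin k ((C : Set K) ∪ {y : K | ∃ t ∈ T, y = t⁻¹})) :=
    isLocalization_of_forall_exists_eq_mul_inv C _ hCL
      (exists_eq_mul_inv_of_mem_adjoin_union_inv C T hT)
  obtain ⟨⟨m, hm⟩, hmy⟩ := IsIntegral.exists_multiple_integral_of_isLocalization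
    ((IsUnit.submonoid ↥(Algebra.adjoin k ((C : Set K) ∪ {y : K | ∃ t ∈ T, y = t⁻¹}))).comap
      (algebraMap ↥C ↥(Algebra.adjoin k ((C : Set K) ∪ {y : K | ∃ t ∈ T, y = t⁻¹})))) y hy
  rw [Submonoid.mk_smul, Subalgebra.smul_def, smul_eq_mul] at hmy
  -- `m` is a unit of `L`, so `m ≠ 0` and `m⁻¹ ∈ L`
  have hu : IsUnit (algebraMap ↥C ↥(Algebra.adjoin k ((C : Set K) ∪ {y : K | ∃ t ∈ T, y = t⁻¹}))
      m) := hm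
  obtain ⟨b, hb⟩ := hu.exists_right_inv
  have hb' : (m : K) * (b : K) = 1 := by
    change ((algebraMap ↥C ↥(Algebra.adjoin k ((C : Set K) ∪ {y : K | ∃ t ∈ T, y = t⁻¹})) m * b :
        ↥(Algebra.adjoin k ((C : Set K) ∪ {y : K | ∃ t ∈ T, y = t⁻¹}))) : K) =
      ((1 : ↥(Algebra.adjoin k ((C : Set K) ∪ {y : K | ∃ t ∈ T, y = t⁻¹}))) : K)
    rw [hb]
  have hm0 : (m : K) ≠ 0 := left_ne_zero_of_mul_eq_one hb'
  have hinv : (m : K)⁻¹ = b := inv_eq_of_mul_eq_one_right hb'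
  refine ⟨m, m.2, hm0, ?_, hmy⟩
  rw [hinv]
  exact b.2

/-- **Normalisation commutes with adjoining inverses.** For a `k`-subalgebra `C` of the field
`K` and `T ⊆ C`: `nrm (C[t⁻¹ | t ∈ T]) = (nrm C)[t⁻¹ | t ∈ T]`. `⊇` by monotonicity of `nrm`
and `C[T⁻¹] ≤ nrm (C[T⁻¹])`; `⊆` by `exists_mul_isIntegral_of_isIntegral_adjoin_union_inv`:
`y = m⁻¹ * (m * y)` with `m⁻¹ ∈ C[T⁻¹] ≤ (nrm C)[T⁻¹]` and `m * y ∈ nrm C`.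
[cite: StacksProject, Tag 0307] -/
theorem nrm_adjoin_union_inv (C : Subalgebra k K) (T : Set K) (hT : T ⊆ ↑C) :
    nrm (Algebra.adjoin k ((C : Set K) ∪ {y : K | ∃ t ∈ T, y = t⁻¹})) =
      Algebra.adjoin k ((nrm C : Set K) ∪ {y : K | ∃ t ∈ T, y = t⁻¹}) := by
  apply le_antisymm
  · -- `⊆`
    refine Algebra.adjoin_le fun y hy => ?_
    obtain ⟨m, -, hm0, hmL, hmy⟩ :=
      exists_mul_isIntegral_of_isIntegral_adjoin_union_inv C T hT hy
    have hL : Algebra.adjoin k ((C : Set K) ∪ {y : K | ∃ t ∈ T, y = t⁻¹}) ≤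
        Algebra.adjoin k ((nrm C : Set K) ∪ {y : K | ∃ t ∈ T, y = t⁻¹}) :=
      Algebra.adjoin_mono
        (Set.union_subset_union_left _ (SetLike.coe_subset_coe.mpr (self_le_nrm C)))
    have hN : nrm C ≤ Algebra.adjoin k ((nrm C : Set K) ∪ {y : K | ∃ t ∈ T, y = t⁻¹}) :=
      le_adjoin_union_inv (nrm C) T
    rw [← inv_mul_cancel_left₀ hm0 y]
    exact Subalgebra.mul_mem _ (hL hmL) (hN ((mem_nrm_iff C).mpr hmy))
  · -- `⊇`
    refine Algebra.adjoin_le ?_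
    rintro y (hy | ⟨t, ht, rfl⟩)
    · exact nrm_mono (le_adjoin_union_inv C T) hy
    · exact self_le_nrm _ (Algebra.subset_adjoin (Or.inr ⟨t, ht, rfl⟩))

end

/-- **STUB `stub_nrm_adjoin_inv`: normalisation commutes with adjoining inverses.** For a
`k`-subalgebra `C` of the field `K` and `T ⊆ C`, the `k`-algebra generated by the elements of
`K` integral over `C[t⁻¹ | t ∈ T]` is `(nrm C)[t⁻¹ | t ∈ T]`, `nrm C` being the `k`-algebra
generated by the elements integral over `C` (`C[T⁻¹]` is a localisation of `C`, and integral
closure commutes with localisation — `nrm_adjoin_union_inv`). [cite: StacksProject, Tag 0307] -/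
theorem stub_nrm_adjoin_inv : ∀ (k K : Type) [Field k] [Field K] [Algebra k K]
    (C : Subalgebra k K) (T : Set K), T ⊆ ↑C →
    Algebra.adjoin k {y : K | IsIntegral
        ↥(Algebra.adjoin k ((C : Set K) ∪ {y : K | ∃ t ∈ T, y = t⁻¹})) y} =
      Algebra.adjoin k (((Algebra.adjoin k {y : K | IsIntegral ↥C y} : Subalgebra k K) : Set K) ∪
        {y : K | ∃ t ∈ T, y = t⁻¹}) :=
  fun _ _ _ _ _ C T hT => nrm_adjoin_union_inv C T hT

end Summit.ResolutionOfSingularities.ResolutionOfSingularities.Theorems.HomologicalConductor.PersistenceNrmAdjoinInv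

end
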